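import Summits.FinalStateConjecture.FinalStateConjecture.Theorems.NearExtremalKappaCapture.Negative.TruncationTraps

/-!
# `NearExtremalKappaCapture` (crux stmt-FinalStateConjecture-10606, route PhaseMixingCapture):
# threshold traps — the basin edge through the sub-extremality conjunct
# (negative-side support, cdisprove seat, cycle 3)

Companion to `ExponentMonotonicity.lean` (p73006: `CaptureWith`, `captureWith_mono`,
`ExtremalFormationInBasin`, `captureWith_false_of_extremalFormation`, `extremalityGap_ge`) and
`TruncationTraps.lean` (p76436: `TruncationTrap θ`, `spin_of_kappaSq`). Nothing here closes the
crux; everything is `sorry`-free over the companions' definitions.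

`ExtremalFormationInBasin.anti` (the third-law fork is antitone in `γ`); `ThresholdTrap θ s δ a₁`
(at every near-extremal spin a vacuum datum within `Kχ^θ` of the Kerr datum with a maximal
development admitting NO sub-extremal Kerr–Schild `C⁰`-limit — the `IsSubextremal M' a'`-analogue
of `TruncationTrap θ`, which negates `FarComplete` instead) ⇒ `extremalFormation_of_thresholdTrap`
(every `γ < θ`) ⇒ `captureWith_false_of_thresholdTrap`; conversely `ExtremalFormationCost θ`
(non-capturable data cost `dist ≥ Mχ^θ/K`) ⇒ `not_extremalFormation_of_cost` (the fork is barred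
for every `γ ≥ θ`). So where trap order = cost order the fork's threshold in `γ` is EXACT.

DICTIONARY. The typed `dist` (`InitialDataSet.dataWeightedSobolevEDist`) is a NORM of the data
difference (`(∑ ∫ (1+|x|)^{2(δ+m)}‖Dᵐ·‖²)^{1/2}`, WeightedNorms.lean), so `dist ≍ amplitude` and
radiated `(E, J) ≍ dist²`; a Kerr parameter is unpinned in `H^s_δ` iff moving it costs finite
distance (mass: `δ < −1/2`; spin / centre / axis: `δ < 1/2`). ON PAPER: `θ = 1` where the spin
is unpinned — the non-subextremal members `Kerr(M, a')`, `a' ≥ M`, restricted to `Kerr.slice a M`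
(`dist ≍ a' − a ≥ M − a ≍ Mχ/2`; their MGHD is `Kerr(M, a')` to the future, rigid against
sub-extremal `C⁰`-limits) and cost `≍ χ`; `θ = 1/2` in every norm and sharp for pinned
`δ ≥ 1/2` — radiating `E ≍ dist² ≥ M − √(aM) ≥ Mχ/4` (`extremalityGap_ge`) onto the extremal
threshold leaf (Angelopoulos–Kehle–Unger arXiv:2603.10378, Conj. 1 (ii); realisability =
Kehle–Unger-type extremal formation, arXiv:2402.10190; numerics at the extremal critical point:
East, PRL 136 (2026) 151401 = arXiv:2511.20567, `τ ≈ κ⁻¹`). This is the "energetically `γ < 1/2`"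
of `ExponentMonotonicity` §4 (pinned norms; its parenthetical "`√dist ∼` amplitude" should read
"`dist ∼` amplitude"), now with the converse bound and with the order-one member fork for
`δ < 1/2`. Consequence: `γ ≥ 1` is necessary for `δ < 1/2`, `γ ≥ 1/2` in every norm.

References: Angelopoulos–Kehle–Unger arXiv:2603.10378; Kehle–Unger arXiv:2402.10190; East,
PRL 136 (2026) 151401; Yang–Zimmerman–Lehner arXiv:1402.4859 (onset amplitude `h₀ ≍ κ̂`, i.e.
`dist ≍ √χ`: order ½ as well).
-/

noncomputable section

set_option linter.dupNamespace false

namespace Summit.FinalStateConjecture.FinalStateConjecture.Theorems.NearExtremalKappaCapture.Negative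

open Literature.Geometry.Lorentzian
open scoped Manifold ContDiff Topology ENNReal
open Set Filter

/-! ## §9  Threshold traps: the basin edge through the sub-extremality conjunct

DICTIONARY (settles the exponent slips of earlier versions): `dataWeightedSobolevEDist` is a NORM of
the difference of the data components (WeightedNorms.lean: `(∑ ∫ (1+|x|)^{2(δ+m)}‖Dᵐ·‖²)^{1/2}`),
so `dist ≍ amplitude` of the perturbation (exactly linear along a fixed profile), radiated energy
and angular momentum are `≍ amplitude² ≍ dist²`, and the typed modulus `Cχ^{-p}√dist` is a
HÖLDER-½ modulus. A Kerr parameter is "unpinned" in `H^s_δ` when moving it costs finite distance: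
the mass for `δ < −1/2` (`r⁻¹` tails), the spin / centre / axis for `δ < 1/2` (`r⁻²` tails);
for `δ ≥ 1/2` all Poincaré charges are pinned and data at finite distance from `Kerr.data M a M`
carry exactly the charges `(M, aM)`. -/

/-- `ExtremalFormationInBasin` is ANTItone in the basin exponent: non-subextremal limits forming
inside every `cχ^{γ'}`-basin form inside every `cχ^γ`-basin, `γ ≤ γ'` (`χ^{γ'} ≤ χ^γ` on
`(0, 1]`). So the set of `γ` reached by the third-law fork is a DOWN-set and has a threshold. -/
theorem ExtremalFormationInBasin.anti [Kerr.Facts] [Kerr.SliceFacts] {s : ℕ}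
    {δ γ γ' a₁ : ℝ} (h : ExtremalFormationInBasin s δ γ' a₁) (hγ : γ ≤ γ') :
    ExtremalFormationInBasin s δ γ a₁ := by
  obtain ⟨M, hM, h⟩ := h
  refine ⟨M, hM, fun c hc ↦ ?_⟩
  obtain ⟨a, ha, hsub, D, inst, hvac, hdist, 𝒟, hmax, hlim⟩ := h c hc
  obtain ⟨hx0, hx1⟩ := kappaSq_pos_le_one hsub
  refine ⟨a, ha, hsub, D, inst, hvac, hdist.trans_le (ENNReal.ofReal_le_ofReal ?_), 𝒟, hmax, hlim⟩
  exact mul_le_mul_of_nonneg_left (Real.rpow_le_rpow_of_exponent_ge hx0 hx1 hγ) hc.le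

/-- **A threshold trap of order `θ`** (`ThresholdTrap θ s δ a₁`): for every `M > 0` there is `K`
such that at every spin `a₁M ≤ |a| < M` some vacuum datum on `Kerr.slice a M` lies within
`dist_{s,δ} ≤ Kχ^θ` (`χ = 1 − a²/M²`) of the Kerr datum and has a maximal vacuum Cauchy
development NONE of whose Kerr–Schild `C⁰`-limits `(M', a')` is sub-extremal — the
`IsSubextremal M' a'`-analogue of `TruncationTrap θ` (which negates `FarComplete` instead).
ON PAPER: (a) ORDER ONE for `δ < 1/2` (spin unpinned): the non-subextremal MEMBERS `Kerr(M, a')`,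
`a' ≥ M` (Kerr–Schild time slice `{x⁰ = 0}`, same `E3`) restricted to `Kerr.slice a M` — smooth
there (the ring `{ρ = a', z = 0}` has `r_a = √(a'² − a²) < M`), differing from `Kerr.data M a M`
by `(a' − a)·∂_a(h, k) = O((a' − a)r⁻²)`, so `dist ≍ a' − a ≥ M − a = Mχ/(1 + a/M)`; for
`a' = M` the edge `{r_a = M}` has `r_M ∈ [a, M]` (inside the extremal horizon except at the
poles; checked numerically), the MGHD contains the whole exterior future and IS `Kerr(M, a')`
there, which converges to no sub-extremal Kerr in `C⁰` on full slabs (rigidity). (b) ORDER ½ in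
every norm, in particular for pinned `δ ≥ 1/2`: radiative tuning onto the extremal threshold leaf
of AKU's Conjecture 1 (ii) — with charges `(M, aM)` pinned, an extremal hole forms only after
radiating `E = M − √(aM − J_rad) ≥ M − √(aM) ≥ Mχ/4` (`extremalityGap_ge`; counter-rotating
emission `J_rad < 0` helps but is itself `O(amplitude²)`), i.e. at `amplitude² ≍ dist² ≍ χ`,
`dist ≍ √χ` (realisability = Kehle–Unger-type extremal Kerr formation in vacuum: open; model
theorems arXiv:2402.10190, numerics at the critical point arXiv:2511.20567).
[cite: KehleUnger2024] -/
def ThresholdTrap [Kerr.Facts] [Kerr.SliceFacts] (θ : ℝ) (s : ℕ) (δ a₁ : ℝ) : Prop :=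
  ∀ (M : ℝ) (hM : 0 < M), ∃ K : ℝ, ∀ a : ℝ, a₁ * M ≤ |a| → |a| < M →
    ∃ (D : InitialDataSet 𝓘(ℝ, E3) (Kerr.slice a M)) (_ : D.metric.HasLeviCivita),
      D.IsVacuumConstraintSolution ∧
        InitialDataSet.dataWeightedSobolevEDist s δ D (Kerr.data M a M hM.le) ≤
            ENNReal.ofReal (K * (1 - (a / M) ^ 2) ^ θ) ∧
          ∃ 𝒟 : VacuumCauchyDevelopment D, 𝒟.IsMaximal ∧
            ∀ (M' a' : ℝ) (𝒟oc : Set 𝒟.carrier),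
              𝒟.toSpacetime.ConvergesToKerr 𝒟oc M' a' 0 → ¬ Kerr.IsSubextremal M' a'

/-- Threshold traps are monotone: a trap of order `θ` is a trap of every order `θ' ≤ θ`
(`χ^θ ≤ χ^θ'` on `(0, 1]`), of every weaker norm `s' ≤ s`, `δ' ≤ δ`, and of every smaller spin
range (verbatim `TruncationTrap.mono`). -/
theorem ThresholdTrap.mono [Kerr.Facts] [Kerr.SliceFacts] {θ θ' : ℝ} {s s' : ℕ}
    {δ δ' a₁ a₁' : ℝ} (h : ThresholdTrap θ s δ a₁) (hθ : θ' ≤ θ) (hs : s' ≤ s) (hδ : δ' ≤ δ)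
    (ha : a₁ ≤ a₁') : ThresholdTrap θ' s' δ' a₁' := by
  intro M hM
  obtain ⟨K, hK⟩ := h M hM
  refine ⟨max K 0, fun a ha' haM ↦ ?_⟩
  obtain ⟨D, inst, hvac, hle, 𝒟, hmax, hlim⟩ :=
    hK a ((mul_le_mul_of_nonneg_right ha hM.le).trans ha') haM
  obtain ⟨hx0, hx1⟩ := kappaSq_pos_le_one (show Kerr.IsSubextremal M a from haM)
  refine ⟨D, inst, hvac, ?_, 𝒟, hmax, hlim⟩
  calc InitialDataSet.dataWeightedSobolevEDist s' δ' D (Kerr.data M a M hM.le)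
      ≤ InitialDataSet.dataWeightedSobolevEDist s δ D (Kerr.data M a M hM.le) :=
        dataWeightedSobolevEDist_mono hs hδ _ _
    _ ≤ ENNReal.ofReal (K * (1 - (a / M) ^ 2) ^ θ) := hle
    _ ≤ ENNReal.ofReal (max K 0 * (1 - (a / M) ^ 2) ^ θ') := by
        refine ENNReal.ofReal_le_ofReal ?_
        calc K * (1 - (a / M) ^ 2) ^ θ ≤ max K 0 * (1 - (a / M) ^ 2) ^ θ :=
              mul_le_mul_of_nonneg_right (le_max_left _ _) (Real.rpow_nonneg hx0.le _)
          _ ≤ max K 0 * (1 - (a / M) ^ 2) ^ θ' :=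
              mul_le_mul_of_nonneg_left (Real.rpow_le_rpow_of_exponent_ge hx0 hx1 hθ)
                (le_max_right _ _)

/-- **A threshold trap of order `θ` puts non-subextremal limits inside every basin of exponent
`γ < θ`** (`a₁ < 1`): at `M = 1`, given `c`, choose `χ` with `Kχ^θ < cχ^γ` and the spin
`a = √(1 − χ)`. The computation is that of `captureWith_false_of_truncationTrap`. -/
theorem extremalFormation_of_thresholdTrap [Kerr.Facts] [Kerr.SliceFacts] {θ : ℝ} {s : ℕ}
    {δ γ a₁ : ℝ} (ha₁ : a₁ < 1) (hT : ThresholdTrap θ s δ a₁) (hγ : γ < θ) :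
    ExtremalFormationInBasin s δ γ a₁ := by
  refine ⟨1, one_pos, fun c hc ↦ ?_⟩
  obtain ⟨K, hK⟩ := hT 1 one_pos
  -- constants
  set K' : ℝ := max K 0 + 1 with hK'
  have hK'pos : 0 < K' := by positivity
  have hKK' : K ≤ K' := by simp [hK']; linarith [le_max_left K 0]
  set a₀ : ℝ := max a₁ 0 with ha₀
  have ha₀0 : 0 ≤ a₀ := le_max_right _ _
  have ha₀1 : a₀ < 1 := max_lt ha₁ one_pos
  have hx₀ : 0 < 1 - a₀ ^ 2 := by nlinarith
  set e : ℝ := θ - γ with he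
  have he0 : 0 < e := by linarith
  set q : ℝ := c / (2 * K') with hq
  have hq0 : 0 < q := by positivity
  set χ₁ : ℝ := q ^ (1 / e) with hχ₁
  have hχ₁0 : 0 < χ₁ := Real.rpow_pos_of_pos hq0 _
  set χ : ℝ := min χ₁ (1 - a₀ ^ 2) with hχdef
  have hχ0 : 0 < χ := lt_min hχ₁0 hx₀
  have hχle : χ ≤ 1 - a₀ ^ 2 := min_le_right _ _
  -- `χ^e ≤ q`, hence `K' χ^θ ≤ (c/2) χ^γ < c χ^γ`
  have hχe : χ ^ e ≤ q := by
    calc χ ^ e ≤ χ₁ ^ e := Real.rpow_le_rpow hχ0.le (min_le_left _ _) he0.le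
      _ = q := by
          rw [hχ₁, ← Real.rpow_mul hq0.le, one_div_mul_cancel he0.ne', Real.rpow_one]
  have hsplit : χ ^ θ = χ ^ e * χ ^ γ := by
    rw [← Real.rpow_add hχ0, he, sub_add_cancel]
  have hχγ0 : 0 < χ ^ γ := Real.rpow_pos_of_pos hχ0 _
  have hχθ0 : 0 ≤ χ ^ θ := Real.rpow_nonneg hχ0.le _
  have hKχ : K' * χ ^ θ < c * χ ^ γ := by
    calc K' * χ ^ θ = (K' * χ ^ e) * χ ^ γ := by rw [hsplit, mul_assoc]
      _ ≤ (K' * q) * χ ^ γ :=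
          mul_le_mul_of_nonneg_right (mul_le_mul_of_nonneg_left hχe hK'pos.le) hχγ0.le
      _ = (c / 2) * χ ^ γ := by rw [hq]; field_simp
      _ < c * χ ^ γ := by nlinarith
  -- the spin and the trapped datum
  obtain ⟨ha₀a, ha1, haχ⟩ := spin_of_kappaSq hχ0 ha₀0 hχle
  set a : ℝ := √(1 - χ) with ha_def
  have ha0 : 0 ≤ a := Real.sqrt_nonneg _
  have habs : |a| = a := abs_of_nonneg ha0
  have ha₁a : a₁ * 1 ≤ |a| := by rw [mul_one, habs]; exact (le_max_left _ _).trans ha₀a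
  have hsub : Kerr.IsSubextremal 1 a := by show |a| < 1; rwa [habs]
  have hχa : 1 - (a / 1) ^ 2 = χ := by rw [div_one]; exact haχ
  obtain ⟨D, inst, hvacD, hle, 𝒟, hmax, hlim⟩ := hK a ha₁a (by rwa [habs])
  refine ⟨a, ha₁a, hsub, D, inst, hvacD, ?_, 𝒟, hmax, hlim⟩
  refine hle.trans_lt ((ENNReal.ofReal_lt_ofReal_iff (by rw [hχa]; positivity)).mpr ?_)
  rw [hχa]
  calc K * χ ^ θ ≤ K' * χ ^ θ := mul_le_mul_of_nonneg_right hKK' hχθ0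
    _ < c * χ ^ γ := hKχ

/-- **A threshold trap of order `θ` refutes every basin exponent `γ < θ`** (all `k, p`), through
the conjunct `Kerr.IsSubextremal M' a'` (landed `captureWith_false_of_extremalFormation`). With
the paper traps of the docstring of `ThresholdTrap`: `γ ≥ 1` is necessary whenever the spin is
unpinned (`δ < 1/2` — including the mass-pinned range `−1/2 ≤ δ < 1/2`, where the truncation traps
of §6 only reach order `1/2`), and `γ ≥ 1/2` is necessary in EVERY norm. -/
theorem captureWith_false_of_thresholdTrap [Kerr.Facts] [Kerr.SliceFacts] {θ : ℝ} {s : ℕ}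
    {δ : ℝ} {k : ℕ} {γ p a₁ : ℝ} (ha₁ : a₁ < 1) (hT : ThresholdTrap θ s δ a₁) (hγ : γ < θ) :
    ¬ CaptureWith s δ k γ p a₁ :=
  captureWith_false_of_extremalFormation (extremalFormation_of_thresholdTrap ha₁ hT hγ) k p

/-- **`ExtremalFormationCost θ s δ a₁`** — the price, of order `θ`, of leaving the sub-extremal
class: for every `M > 0` there is `K > 0` such that at every spin `a₁M ≤ |a| < M`, every vacuum
datum on `Kerr.slice a M` having a maximal development with NO sub-extremal Kerr–Schild
`C⁰`-limit lies at distance `≥ Mχ^θ/K` from the Kerr datum. ON PAPER (dictionary above): `θ = 1`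
for `δ < 1/2` (the cheapest route is the member `Kerr(M, M)` at `dist ≍ M − a ≍ χ`; every
radiative route costs `dist ≳ √χ ≫ χ`), and `θ = 1/2` for pinned `δ ≥ 1/2` (`E_rad ≍ dist² ≥
M − √(aM) ≥ Mχ/4`, `extremalityGap_ge`). [folklore] -/
def ExtremalFormationCost [Kerr.Facts] [Kerr.SliceFacts] (θ : ℝ) (s : ℕ) (δ a₁ : ℝ) : Prop :=
  ∀ (M : ℝ) (hM : 0 < M), ∃ K > (0 : ℝ), ∀ a : ℝ, a₁ * M ≤ |a| → Kerr.IsSubextremal M a →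
    ∀ (D : InitialDataSet 𝓘(ℝ, E3) (Kerr.slice a M)) [D.metric.HasLeviCivita],
      D.IsVacuumConstraintSolution →
        (∃ 𝒟 : VacuumCauchyDevelopment D, 𝒟.IsMaximal ∧
          ∀ (M' a' : ℝ) (𝒟oc : Set 𝒟.carrier),
            𝒟.toSpacetime.ConvergesToKerr 𝒟oc M' a' 0 → ¬ Kerr.IsSubextremal M' a') →
          ENNReal.ofReal (M * (1 - (a / M) ^ 2) ^ θ / K) ≤
            InitialDataSet.dataWeightedSobolevEDist s δ D (Kerr.data M a M hM.le)

/-- **Granted a cost of order `θ`, the third-law fork is BARRED for every `γ ≥ θ`** (with basin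
constant `c = M/K` at the mass `M` of the fork): `Mχ^θ/K ≤ dist < cχ^γ ≤ (M/K)χ^θ` is absurd
(`χ^γ ≤ χ^θ` on `(0, 1]`). With `extremalFormation_of_thresholdTrap` the fork's threshold is
EXACTLY the common order of trap and cost: `γ = 1` for `δ < 1/2`, `γ = 1/2` for `δ ≥ 1/2`.
(`ExponentMonotonicity` §4's "energetically plausible exactly when `γ < 1/2`" is the pinned-norm
value — its parenthetical "`√dist ∼` amplitude" should read "`dist ∼` amplitude" — and misses the
order-one member fork available whenever the spin is unpinned.) -/
theorem not_extremalFormation_of_cost [Kerr.Facts] [Kerr.SliceFacts] {θ : ℝ} {s : ℕ}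
    {δ γ a₁ : ℝ} (hcost : ExtremalFormationCost θ s δ a₁) (hγ : θ ≤ γ) :
    ¬ ExtremalFormationInBasin s δ γ a₁ := by
  rintro ⟨M, hM, h⟩
  obtain ⟨K, hK, hcost⟩ := hcost M hM
  obtain ⟨a, ha, hsub, D, inst, hvac, hdist, 𝒟, hmax, hlim⟩ := h (M / K) (by positivity)
  haveI := inst
  obtain ⟨hx0, hx1⟩ := kappaSq_pos_le_one hsub
  have hle := hcost a ha hsub D hvac ⟨𝒟, hmax, hlim⟩
  have hlt := hle.trans_lt hdist
  have hq : 0 < M / K * (1 - (a / M) ^ 2) ^ γ :=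
    mul_pos (by positivity) (Real.rpow_pos_of_pos hx0 _)
  rw [ENNReal.ofReal_lt_ofReal_iff hq] at hlt
  have hpow : (1 - (a / M) ^ 2) ^ γ ≤ (1 - (a / M) ^ 2) ^ θ :=
    Real.rpow_le_rpow_of_exponent_ge hx0 hx1 hγ
  have : M / K * (1 - (a / M) ^ 2) ^ γ ≤ M * (1 - (a / M) ^ 2) ^ θ / K := by
    calc M / K * (1 - (a / M) ^ 2) ^ γ ≤ M / K * (1 - (a / M) ^ 2) ^ θ :=
          mul_le_mul_of_nonneg_left hpow (by positivity)
      _ = M * (1 - (a / M) ^ 2) ^ θ / K := by ring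
  linarith

end Summit.FinalStateConjecture.FinalStateConjecture.Theorems.NearExtremalKappaCapture.Negative

end
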